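import Summits.QuantumFields.BalabanUV.T4Continuum.Support.ShellMeasureSlotDimension
import Literature.MathematicalPhysics.QuantumFieldTheory.Balaban1983to89.T4AxialGaugeFixing

/-!
# `T4Continuum.ShellMeasureSlotDimensionExact` — THE DESIGNED BLOCK's DIMENSION EXACTLY: the axial comb of a non-wrapping
# box has `#Icc lo hi − 1` bonds (`(M+1)^d − 1` on a cube), hence the block `Λ = boxBonds ∖ comb` of the END hosts ∕ toys ∕
# the ONE CALL's Gibbs leg has `#Λ = d·M·(M+1)^{d−1} − ((M+1)^d − 1)` and `m₀ = 3·#Λ` EXACTLY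
(cell `pub-balaban`, sub-cell `t4`, spine estimate NE7c (node U5b); NE7c ROUND-2 crew, unit `b2b-balaban-t4-ne7c-formalise-leaf-01`
gen 10; owner-table row **S101 f2** (`t4/b2b-balaban-t4-ne7c-p1/LEAVES-NE7c-P1.md`; owner GO R-ne7cp1-g36-2 (c), journal l.21166, on
this seat's OFFER «THE COMB COUNT IN KERNEL» l.21063) — S-sized COMPANION of row S101 «THE DIMENSION SUMMAND `m₀` OF THE SLOT CONSTANT
IN KERNEL» (leaf-09-g13's `ShellMeasureSlotDimension` p234597 ✓, read by this seat C-ne7cleaf01g10-2); closes the one item S101's header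
flags «NOT kernel-checked here» — the comb count `#comb = (M+1)^d − 1`; ADDITIVE — imports S101 `ShellMeasureSlotDimension` + Literature
`T4AxialGaugeFixing` ONLY; [folklore]; 0 `def`, 0 `def … : Prop`, 0 sorry, 0 citation tags.)

HONEST FRAMING.  Finite four-torus programme, rung (B)+1 only — NOT infinite volume, NOT a mass gap, NOT the Clay problem, NOT
summit progress; (B), `BetaPertHyp`, (B^μ) not consumed.  NE7c (`T4IndicatorShell.ShellWeightBound`) is NOT PRINTED in
[Balaban 1983–89] and NOT PROVED; «NE7c ⇐ the named binders» (trigger c3).  This file is FINITE COMBINATORICS ON OUR OWN BINDER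
SHAPES (the box ∕ comb ∕ block hypotheses `hΛbox`, `hΛcomb`, `hcov` of the END hosts S80 f6∕f7 and of the ONE CALL's Gibbs leg,
S95 f3′ ∕ S102 f3″); nothing of Bałaban's is asserted, cited or discharged; no binder enters or leaves any END (census class [R]
made exact).  HONEST DEPENDENCY (cell): continuum YM on T⁴ ⇐ BetaPertH ∧ nine spine estimates (0/9 proved); BetaPertH ⇐ (D1) ∧
(D4) ∧ CAP+tail; G-an2-4 gates asym, D1 and NE2/3/4.

THE POINT.  S101 pins `m₀ = 3·#Λ` (`m₀_eq_three_mul_card`), CAPS `#Λ ≤ d(M+1)^d` for any chart in a side-`M` box of its own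
lattice (§2) and counts the BOX bonds exactly, `#boxBonds = d·M·(M+1)^{d−1}` on a non-wrapping cube (§2b); its §4 then brackets
the DESIGNED block `box ∖ comb` using «`#comb = (M+1)^d − 1` — the axial comb is a spanning tree of the `(M+1)^d` box sites, NOT
kernel-checked here».  HERE that count is kernel:
* §1 **`card_combBonds_eq`**: on a NON-WRAPPING box (`hi κ − lo κ < sitesPerDir j`) with `lo ≤ hi`,
  `#(combBonds lo hi) = #(Icc lo hi) − 1 = ∏_κ (hi κ + 1 − lo κ).toNat − 1` — the spanning-tree bijection «comb bond ↦ its outer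
  endpoint»: `PBond.tgt` is injective on the comb (`T4AxialGaugeFixing.treeOrder_combBonds (hN).inj`, in the tree), the target of
  `⟨castSite x, μ⟩` is `castSite (x + e_μ)`, a box site `≠ castSite lo`, and every box site `y ≠ lo` is the target of exactly the
  comb bond `⟨castSite (y − e_μ), μ⟩`, `μ := min {κ ∣ y κ ≠ lo κ}` (`exists_comb_tgt_eq`); **`card_combBonds_side`**: `= (M+1)^d − 1`
  on a cube `hi = lo + M`.
* §2 **`block_eq_sdiff`** ∕ **`card_block_eq`**: the three block binders `hΛbox : Λ ⊆ boxBonds`, `hΛcomb : Disjoint Λ comb`,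
  `hcov : boxBonds ∖ Λ ⊆ comb` force `Λ = boxFinset ∖ combBonds`, so `#Λ = #boxBonds − #comb`; on a non-wrapping cube
  **`card_block_side`**: `#Λ = d·M·(M+1)^{d−1} − ((M+1)^d − 1)` (S101 `card_boxBonds_side` + §1).
* §3 **`m₀_eq_of_block`**: `m₀ = 3·(d·M·(M+1)^{d−1} − ((M+1)^d − 1))` EXACTLY for the designed block; S101 §4's illustrative
  numbers become statements about the designed block: `d = 4, M = 2 ⟹ #Λ = 136, m₀ = 408`; `d = 2, M = 2 ⟹ #Λ = 4, m₀ = 12`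
  (S89∕S96's toy blocks); `d = 4, M = 13 ⟹ #Λ = 104 273, m₀ = 312 819` (`numbers_d4_side2` etc., `decide`-free `norm_num`).
* §4 THE ONE-CALL SHAPE (Gibbs leg of S95 f3′ ∕ S102 f3″: binders `lo₀ hi₀ hN₀ hΛbox₀ hΛcomb₀` + `hcov`, chart `eg`): on CUBIC
  boxes `hi = lo + Ms r (lvl r K s)` the dimension `m₀g r K s` IS the level profile
  `3·(d·Ms·(Ms+1)^{d−1} − ((Ms+1)^d − 1))` at `Ms = Ms r (lvl r K s)` (**`m₀_gibbs_eq_profile`**) — determined by the box binders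
  alone, not only capped (S101 `hDslot_dim_of_box`).
WHAT THIS DOES NOT DO.  Which box a live slot's chart designates (the classifier cube `□` of [Balaban1988Convergent] (2.17) or
the localization domain `□^{∼4}` of (2.16) — S101's READING vs WALL §2b R01, my XREAD INFO C-ne7cleaf01g10-2) is node O's [dict]
business and untouched here; the side profile stays COUPLING-DEPENDENT and DISPLAYED (S101 §3, owner R-ne7cp1-g35-2 (c)).  NOTHING
in the countdown moves; NE7c NOT PROVED; spine PROVED 0∕9.
-/

open Finset

namespace Summit.QuantumFields.BalabanUV.T4Continuum.ShellMeasureSlotDimensionExact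

open Literature.MathematicalPhysics.QuantumFieldTheory.Balaban1983to89
open T4AxialGaugeSmallField (castSite castSite_add_e castSite_injOn_box boxBonds)
open T4AxialGaugeFixing (combSet combBonds mem_combBonds treeOrder_combBonds combSet_subset_boxBonds)
open B7Prop1Explicit (e e_apply)
open B8Lemma1NonAbelian (lowPart lowPart_apply e_nonneg)
open ShellMeasureSlotDimension (m₀_eq_three_mul_card card_boxBonds_side)

variable {P : Params} {j : ℕ}

/-! ## §1 The comb count: `#comb = #Icc lo hi − 1` -/

/-- the target of a comb bond `⟨castSite x, μ⟩` is the box site `castSite (x + e_μ)`, and `x + e_μ ≠ lo`. [folklore] -/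
theorem exists_tgt_of_mem_combBonds {lo hi : Fin P.d → ℤ} {b : PBond P j} (hb : b ∈ combBonds lo hi) :
    ∃ y : Fin P.d → ℤ, lo ≤ y ∧ y ≤ hi ∧ y ≠ lo ∧ b.tgt = castSite y := by
  obtain ⟨x, hlo, hhi, hsrc, _⟩ := mem_combBonds.1 hb
  refine ⟨x + e b.dir, hlo.trans (le_add_of_nonneg_right (e_nonneg _)), hhi, fun h => ?_, ?_⟩
  · have h1 := congr_fun h b.dir
    have h2 := hlo b.dir
    rw [Pi.add_apply, e_apply, if_pos rfl] at h1
    linarith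
  · rw [PBond.tgt, hsrc, castSite_add_e]

/-- every box site other than the corner is the target of a comb bond: `y ↦ ⟨castSite (y − e_μ), μ⟩` with `μ` the FIRST
coordinate in which `y` differs from `lo` (the spanning-tree structure of the axial comb). [folklore] -/
theorem exists_comb_tgt_eq {lo hi : Fin P.d → ℤ} {y : Fin P.d → ℤ} (hlo : lo ≤ y) (hhi : y ≤ hi) (hne : y ≠ lo) :
    ∃ b ∈ (combBonds lo hi : Finset (PBond P j)), b.tgt = castSite y := by
  classical
  have hD : (univ.filter fun κ : Fin P.d => y κ ≠ lo κ).Nonempty := by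
    by_contra h
    rw [not_nonempty_iff_eq_empty, filter_eq_empty_iff] at h
    exact hne (funext fun κ => not_not.1 (h (mem_univ κ)))
  set μ := (univ.filter fun κ : Fin P.d => y κ ≠ lo κ).min' hD with hμ
  have hμmem : y μ ≠ lo μ := (mem_filter.1 (min'_mem _ hD)).2
  have hμmin : ∀ κ, κ < μ → y κ = lo κ := fun κ hκ => by
    by_contra h
    exact absurd (min'_le _ κ (mem_filter.2 ⟨mem_univ κ, h⟩)) (not_le.2 (hμ ▸ hκ))
  refine ⟨⟨castSite (y - e μ), μ⟩, mem_combBonds.2 ⟨y - e μ, fun κ => ?_, by rw [sub_add_cancel]; exact hhi, rfl, ?_⟩, ?_⟩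
  · simp only [Pi.sub_apply, e_apply]
    split_ifs with h
    · subst h
      have := lt_of_le_of_ne (hlo μ) (Ne.symm hμmem)
      linarith
    · simp only [sub_zero]; exact hlo κ
  · funext κ
    simp only [lowPart_apply, Pi.sub_apply, e_apply, Pi.zero_apply]
    split_ifs with h1 h2
    · exact absurd h2 (ne_of_lt h1)
    · rw [hμmin κ h1]; ring
    · rfl
  · simp only [PBond.tgt]
    rw [← castSite_add_e, sub_add_cancel]

/-- **THE COMB COUNT.**  On a NON-WRAPPING box (`hi κ − lo κ < sitesPerDir j`) with `lo ≤ hi`, the axial comb has exactly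
`#(Icc lo hi) − 1` bonds — one per box site other than the corner (`PBond.tgt` is injective on the comb,
`treeOrder_combBonds.inj`, and §1's two lemmas identify its image). [folklore] -/
theorem card_combBonds_eq (lo hi : Fin P.d → ℤ) (hN : ∀ κ, hi κ - lo κ < P.sitesPerDir j) (hlohi : lo ≤ hi) :
    (combBonds lo hi : Finset (PBond P j)).card = (Finset.Icc lo hi).card - 1 := by
  classical
  have hinj : Set.InjOn PBond.tgt ↑(combBonds lo hi : Finset (PBond P j)) :=
    fun b hb b' hb' h => (treeOrder_combBonds hN).inj b hb b' hb' h
  have himage : (combBonds lo hi : Finset (PBond P j)).image PBond.tgt =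
      ((Finset.Icc lo hi).erase lo).image (fun y => (castSite y : Site P j)) := by
    ext s
    simp only [mem_image, mem_erase, mem_Icc]
    constructor
    · rintro ⟨b, hb, rfl⟩
      obtain ⟨y, hylo, hyhi, hyne, hy⟩ := exists_tgt_of_mem_combBonds hb
      exact ⟨y, ⟨hyne, hylo, hyhi⟩, hy.symm⟩
    · rintro ⟨y, ⟨hyne, hylo, hyhi⟩, rfl⟩
      obtain ⟨b, hb, hbt⟩ := exists_comb_tgt_eq (P := P) (j := j) hylo hyhi hyne
      exact ⟨b, hb, hbt⟩
  have hinj' : Set.InjOn (fun y => (castSite y : Site P j)) ↑((Finset.Icc lo hi).erase lo) := by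
    intro y hy y' hy' h
    simp only [coe_erase, Set.mem_sdiff, mem_coe, mem_Icc] at hy hy'
    exact castSite_injOn_box hN hy.1.1 hy.1.2 hy'.1.1 hy'.1.2 h
  rw [← card_image_of_injOn hinj, himage, card_image_of_injOn hinj', card_erase_of_mem (mem_Icc.2 ⟨le_rfl, hlohi⟩)]

/-- … in closed form: `#comb = ∏_κ (hi κ + 1 − lo κ).toNat − 1`. [folklore] -/
theorem card_combBonds_eq_prod (lo hi : Fin P.d → ℤ) (hN : ∀ κ, hi κ - lo κ < P.sitesPerDir j) (hlohi : lo ≤ hi) :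
    (combBonds lo hi : Finset (PBond P j)).card = (∏ κ, (hi κ + 1 - lo κ).toNat) - 1 := by
  rw [card_combBonds_eq lo hi hN hlohi, Pi.card_Icc]
  simp only [Int.card_Icc]

/-- **ON A CUBE OF SIDE `M`** (`hi = lo + M`, non-wrapping): `#comb = (M+1)^d − 1` — the number S101 §4 used unproved. [folklore] -/
theorem card_combBonds_side (lo hi : Fin P.d → ℤ) {M : ℕ} (hM : ∀ κ, hi κ = lo κ + M)
    (hN : ∀ κ, hi κ - lo κ < P.sitesPerDir j) :
    (combBonds lo hi : Finset (PBond P j)).card = (M + 1) ^ P.d - 1 := by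
  have hlohi : lo ≤ hi := fun κ => by rw [hM κ]; exact le_add_of_nonneg_right (Int.natCast_nonneg M)
  rw [card_combBonds_eq_prod lo hi hN hlohi]
  congr 1
  rw [Finset.prod_eq_pow_card (b := M + 1), Finset.card_univ, Fintype.card_fin]
  intro κ _
  rw [hM κ]
  have : lo κ + (M : ℤ) + 1 - lo κ = ((M + 1 : ℕ) : ℤ) := by push_cast; ring
  rw [this, Int.toNat_natCast]

/-! ## §2 The designed block `Λ = boxBonds ∖ comb` and its exact size -/

/-- **THE THREE BLOCK BINDERS DETERMINE THE BLOCK**: `Λ ⊆ box`, `Λ ∩ comb = ∅`, `box ∖ Λ ⊆ comb` ⟹ `Λ = boxFinset ∖ comb`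
(the shapes `hΛbox`∕`hΛcomb`∕`hcov` of S95 f3′'s Gibbs leg and of S80 f7's box data). [folklore] -/
theorem block_eq_sdiff {lo hi : Fin P.d → ℤ} (Λ : Finset (PBond P j)) [DecidableEq (PBond P j)]
    [DecidablePred fun b : PBond P j => b ∈ boxBonds lo hi]
    (hΛbox : ∀ b ∈ Λ, b ∈ boxBonds lo hi) (hΛcomb : Disjoint Λ (combBonds lo hi))
    (hcov : ∀ b ∈ boxBonds lo hi, b ∉ Λ → b ∈ (combBonds lo hi : Finset (PBond P j))) :
    Λ = (univ.filter fun b : PBond P j => b ∈ boxBonds lo hi) \ combBonds lo hi := by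
  ext b
  simp only [mem_sdiff, mem_filter, mem_univ, true_and]
  constructor
  · exact fun hb => ⟨hΛbox b hb, fun hc => disjoint_left.1 hΛcomb hb hc⟩
  · rintro ⟨hbox, hnc⟩
    by_contra hb
    exact hnc (hcov b hbox hb)

/-- **THE BLOCK SIZE**: `#Λ = #boxBonds − #comb` under the three block binders (the comb lies in the box,
`combSet_subset_boxBonds`). [folklore] -/
theorem card_block_eq {lo hi : Fin P.d → ℤ} (Λ : Finset (PBond P j)) [DecidableEq (PBond P j)]
    [DecidablePred fun b : PBond P j => b ∈ boxBonds lo hi]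
    (hΛbox : ∀ b ∈ Λ, b ∈ boxBonds lo hi) (hΛcomb : Disjoint Λ (combBonds lo hi))
    (hcov : ∀ b ∈ boxBonds lo hi, b ∉ Λ → b ∈ (combBonds lo hi : Finset (PBond P j))) :
    Λ.card = (univ.filter fun b : PBond P j => b ∈ boxBonds lo hi).card - (combBonds lo hi : Finset (PBond P j)).card := by
  rw [block_eq_sdiff Λ hΛbox hΛcomb hcov]
  refine card_sdiff_of_subset fun b hb => mem_filter.2 ⟨mem_univ b, combSet_subset_boxBonds lo hi (mem_combBonds.1 hb)⟩

/-- **ON A NON-WRAPPING CUBE OF SIDE `M`**: `#Λ = d·M·(M+1)^{d−1} − ((M+1)^d − 1)` for the designed block (S101 `card_boxBonds_side`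
+ `card_combBonds_side`). [folklore] -/
theorem card_block_side {lo hi : Fin P.d → ℤ} {M : ℕ} (hM : ∀ κ, hi κ = lo κ + M) (hN : ∀ κ, hi κ - lo κ < P.sitesPerDir j)
    (Λ : Finset (PBond P j)) [DecidableEq (PBond P j)]
    (hΛbox : ∀ b ∈ Λ, b ∈ boxBonds lo hi) (hΛcomb : Disjoint Λ (combBonds lo hi))
    (hcov : ∀ b ∈ boxBonds lo hi, b ∉ Λ → b ∈ (combBonds lo hi : Finset (PBond P j))) :
    Λ.card = P.d * (M * (M + 1) ^ (P.d - 1)) - ((M + 1) ^ P.d - 1) := by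
  classical
  rw [card_block_eq Λ hΛbox hΛcomb hcov, card_boxBonds_side lo hi hM hN, card_combBonds_side lo hi hM hN]

/-! ## §3 `m₀` exactly -/

/-- **THE DESIGNED BLOCK's DIMENSION EXACTLY**: `m₀ = 3·(d·M·(M+1)^{d−1} − ((M+1)^d − 1))` for a chart `e : ↥Λ × Fin 3 ≃ Fin m₀`
of the block `Λ = box ∖ comb` of a non-wrapping side-`M` cube (S101 `m₀_eq_three_mul_card` + §2). [folklore] -/
theorem m₀_eq_of_block {lo hi : Fin P.d → ℤ} {M : ℕ} (hM : ∀ κ, hi κ = lo κ + M) (hN : ∀ κ, hi κ - lo κ < P.sitesPerDir j)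
    (Λ : Finset (PBond P j)) [DecidableEq (PBond P j)]
    (hΛbox : ∀ b ∈ Λ, b ∈ boxBonds lo hi) (hΛcomb : Disjoint Λ (combBonds lo hi))
    (hcov : ∀ b ∈ boxBonds lo hi, b ∉ Λ → b ∈ (combBonds lo hi : Finset (PBond P j)))
    {m₀ : ℕ} (e : ↥Λ × Fin 3 ≃ Fin m₀) :
    m₀ = 3 * (P.d * (M * (M + 1) ^ (P.d - 1)) - ((M + 1) ^ P.d - 1)) := by
  rw [m₀_eq_three_mul_card Λ e, card_block_side hM hN Λ hΛbox hΛcomb hcov]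

/-- S101 §4's numbers, now about the DESIGNED block: `d = 4`, side `2` ⟹ `#Λ = 216 − 80 = 136`, `m₀ = 408`. [folklore] -/
theorem numbers_d4_side2 : 4 * (2 * (2 + 1) ^ (4 - 1)) - ((2 + 1) ^ 4 - 1) = 136 ∧
    3 * (4 * (2 * (2 + 1) ^ (4 - 1)) - ((2 + 1) ^ 4 - 1)) = 408 := by norm_num

/-- `d = 2`, side `2` (S89∕S96's toy boxes on `toyParams`) ⟹ `#Λ = 12 − 8 = 4`, `m₀ = 12`. [folklore] -/
theorem numbers_d2_side2 : 2 * (2 * (2 + 1) ^ (2 - 1)) - ((2 + 1) ^ 2 - 1) = 4 ∧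
    3 * (2 * (2 * (2 + 1) ^ (2 - 1)) - ((2 + 1) ^ 2 - 1)) = 12 := by norm_num

/-- `d = 4`, side `13` ⟹ `#Λ = 142 688 − 38 415 = 104 273`, `m₀ = 312 819`. [folklore] -/
theorem numbers_d4_side13 : 4 * (13 * (13 + 1) ^ (4 - 1)) - ((13 + 1) ^ 4 - 1) = 104273 ∧
    3 * (4 * (13 * (13 + 1) ^ (4 - 1)) - ((13 + 1) ^ 4 - 1)) = 312819 := by norm_num

/-- the exact designed-block dimension at `d = 4`, side `2`, as an instance of `m₀_eq_of_block`'s right side. [folklore] -/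
example {P : Params} (hd : P.d = 4) {lo hi : Fin P.d → ℤ} (hM : ∀ κ, hi κ = lo κ + (2 : ℕ))
    (hN : ∀ κ, hi κ - lo κ < P.sitesPerDir j) (Λ : Finset (PBond P j)) [DecidableEq (PBond P j)]
    (hΛbox : ∀ b ∈ Λ, b ∈ boxBonds lo hi) (hΛcomb : Disjoint Λ (combBonds lo hi))
    (hcov : ∀ b ∈ boxBonds lo hi, b ∉ Λ → b ∈ (combBonds lo hi : Finset (PBond P j)))
    {m₀ : ℕ} (e : ↥Λ × Fin 3 ≃ Fin m₀) : m₀ = 408 := by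
  rw [m₀_eq_of_block hM hN Λ hΛbox hΛcomb hcov e, hd]; norm_num

/-! ## §4 The ONE CALL's Gibbs leg: `m₀g` is a determined level profile on cubic boxes -/

section OneCall

variable {σ₀ : Type*}

/-- **THE GIBBS LEG's DIMENSION IS A DETERMINED LEVEL PROFILE.**  In the ONE CALL's indexing (S95 f3′ ∕ S102 f3″: Gibbs slots
`s : σ₀`, lattice `(Pg r K s, jg r K s)`, box `[lo r K s, hi r K s]` non-wrapping, block `Λg r K s` with `hΛbox`∕`hΛcomb`∕`hcov`,
chart `eg r K s : ↥(Λg r K s) × Fin 3 ≃ Fin (m₀g r K s)`), if the boxes are CUBES of side `Ms r (lvl r K s)` and the dimension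
is `d`, then `m₀g r K s = 3·(d·Ms·(Ms+1)^{d−1} − ((Ms+1)^d − 1))` at `Ms = Ms r (lvl r K s)` — EQUAL to a level profile, so both
`hDslot`'s `m₀`-summand and its cap are read off the side profile (S101 `hDslot_dim_of_box` gave `≤ 3d(Ms+1)^d`). [folklore] -/
theorem m₀_gibbs_eq_profile (Pg : Bool → ℕ → σ₀ → Params) (jg lvl : Bool → ℕ → σ₀ → ℕ)
    (lo hi : ∀ r K s, Fin (Pg r K s).d → ℤ)
    (hN : ∀ r K s κ, hi r K s κ - lo r K s κ < (Pg r K s).sitesPerDir (jg r K s))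
    (Λg : ∀ r K s, Finset (PBond (Pg r K s) (jg r K s))) [∀ r K s, DecidableEq (PBond (Pg r K s) (jg r K s))]
    (hΛbox : ∀ r K s, ∀ b ∈ Λg r K s, b ∈ boxBonds (lo r K s) (hi r K s))
    (hΛcomb : ∀ r K s, Disjoint (Λg r K s) (combBonds (lo r K s) (hi r K s)))
    (hcov : ∀ r K s, ∀ b ∈ boxBonds (lo r K s) (hi r K s), b ∉ Λg r K s →
      b ∈ (combBonds (lo r K s) (hi r K s) : Finset (PBond (Pg r K s) (jg r K s))))
    {m₀g : Bool → ℕ → σ₀ → ℕ} (eg : ∀ r K s, ↥(Λg r K s) × Fin 3 ≃ Fin (m₀g r K s))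
    {d : ℕ} (hd : ∀ r K s, (Pg r K s).d = d) (Ms : Bool → ℕ → ℕ)
    (hside : ∀ r K s κ, hi r K s κ = lo r K s κ + Ms r (lvl r K s)) (r : Bool) (K : ℕ) (s : σ₀) :
    m₀g r K s = 3 * (d * (Ms r (lvl r K s) * (Ms r (lvl r K s) + 1) ^ (d - 1)) - ((Ms r (lvl r K s) + 1) ^ d - 1)) := by
  rw [m₀_eq_of_block (hside r K s) (hN r K s) (Λg r K s) (hΛbox r K s) (hΛcomb r K s) (hcov r K s) (eg r K s), hd r K s]

end OneCall

end Summit.QuantumFields.BalabanUV.T4Continuum.ShellMeasureSlotDimensionExact
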